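import Literature.MathematicalPhysics.QuantumLattice.DWaveSourceProofs
import Literature.MathematicalPhysics.QuantumLattice.LiebFluxPhaseProofs
import Literature.MathematicalPhysics.QuantumLattice.SectorSpectrum

/-!
# Crux `TwSeededEnsembleEquivalence` (stmt-HubbardSuperconductivity-1698), line `exposed-density-duality` — stub `stub_closerSecant` (finite-volume transfer)

FINITE-VOLUME FORM OF THE TRANSFER (lead prover). The closer of the line needs the exposed-density
hypothesis only through the KINK STEP: both one-sided secants of `F_L(μ) = E₀(Hgc_L(μ))` over a step `τ`
at an `L`-independent `μ₀` are within `η L²` of `−(1−δ)L²`, eventually in `L` ("secant bracket"). This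
file proves public, reusable versions of the closer's helpers (`walkDown`, `walkUp`,
`twoFloorHalfBounds`, `closerCore`) and `stub_closerSecant` — ground-sector existence + `S^z = 0`
realises even minima + `T = 0` one-particle cost + SECANT BRACKET ⟹ hull touch (the closer with the
kink step removed) — so that the crux is closed modulo the WEAKER, limit-free statement
`stub_secantBracketT0`; the landed `stub_closer` (module `…Closer`) is exactly "exposed density ⟹
(kink lemma) secant bracket ⟹ this".

Proof (pure real analysis over the four hypotheses; no matrix fact is used here):
* KINK LEMMA (`kink_lemma`): pointwise convergence `F_L(μ)/L² → e(μ)` near `μ₀` and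
  `HasDerivAt e (−(1−δ)) μ₀` pin both one-sided secants of `F_L/L²` at `μ₀` over a step `τ` to
  within `η` of `−(1−δ)`, eventually in `L`;
* SUPERGRADIENT BRACKET: `F_L(μ) = min_N (E_N − μN)` is attained at a ground sector `N*` (first
  hypothesis) and `F_L(μ₀ ± τ) ≤ E_{N*} − (μ₀ ± τ)N*`, so `−N*` lies between the two secants:
  `|N* − (1−δ)L²| ≤ ηL²`, whence `|N* − N_L| ≤ ηL² + 2`;
* WALK (`walk_down`/`walk_up`): `≤ ηL² + 2` one-particle steps from `N*` to `N_L`, each costing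
  `≤ 2C` in energy (third hypothesis, sectors between `L²/2` and `L²`) and `≤ 4` in `μ₀N`;
* `S^z = 0` realises `E_{N_L}` (second hypothesis, `N_L` even), and `η := ε/(2(2C+4))`,
  `L² ≥ 4(2C+4)/ε` finish.
-/

namespace Summit.HubbardSuperconductivity.HubbardSuperconductivity.Theorems.TwSeededEnsembleEquivalence.ExposedDensity

open Matrix Filter Topology Literature.MathematicalPhysics.QuantumLattice
open scoped ComplexOrder Matrix.Norms.L2Operator

noncomputable section

/-! ### Real-analysis helpers -/

/-- Downward walk: `k` one-particle removals, each costing `≤ K`. [folklore] -/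
theorem walkDown (E : ℕ → ℝ) (K : ℝ) (a : ℕ) :
    ∀ k : ℕ, (∀ n : ℕ, a < n → n ≤ a + k → E (n - 1) ≤ E n + K) → E a ≤ E (a + k) + K * k := by
  intro k
  induction k with
  | zero => intro _; simp
  | succ k ih =>
    intro h
    have h1 := ih fun n hn1 hn2 => h n hn1 (by omega)
    have h2 := h (a + k + 1) (by omega) (by omega)
    rw [Nat.add_sub_cancel] at h2
    rw [← add_assoc]
    push_cast
    linarith

/-- Upward walk: `k` one-particle additions, each costing `≤ K`. [folklore] -/
theorem walkUp (E : ℕ → ℝ) (K : ℝ) (a : ℕ) :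
    ∀ k : ℕ, (∀ n : ℕ, a ≤ n → n < a + k → E (n + 1) ≤ E n + K) → E (a + k) ≤ E a + K * k := by
  intro k
  induction k with
  | zero => intro _; simp
  | succ k ih =>
    intro h
    have h1 := ih fun n hn1 hn2 => h n hn1 (by omega)
    have h2 := h (a + k) (by omega) (by omega)
    rw [← add_assoc]
    push_cast
    linarith

/-- `N_L = 2⌊x/2⌋₊` is within `2` below `x ≥ 0`: `x − 2 ≤ N_L ≤ x`. [folklore] -/
theorem twoFloorHalfBounds {x : ℝ} (hx : 0 ≤ x) :
    x - 2 ≤ ((2 * ⌊x / 2⌋₊ : ℕ) : ℝ) ∧ ((2 * ⌊x / 2⌋₊ : ℕ) : ℝ) ≤ x := by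
  have h1 : (⌊x / 2⌋₊ : ℝ) ≤ x / 2 := Nat.floor_le (by linarith)
  have h2 : x / 2 < (⌊x / 2⌋₊ : ℝ) + 1 := Nat.lt_floor_add_one _
  push_cast
  constructor <;> linarith

/-! ### The closer, abstract core (one side length, reals only) -/

/-- Core of the closer at ONE side length `side ≥ 5`, with every matrix quantity abstracted into
real numbers: `F` = grand-canonical ground energy as a function of `μ`, `E` = canonical sector
energies (`Esz` the `S^z = 0` ones), `Ns` = a ground sector at `μ₀`, kink inequalities with
tolerance `η`, one-particle costs with constant `C`. Conclusion: hull touch at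
`N_L = 2⌊(1−δ)side²/2⌋₊` with error `ε side²`. [folklore] -/
theorem closerCore (side : ℕ) (hside : 5 ≤ side) (F : ℝ → ℝ) (E Esz : ℕ → ℝ) (C μ₀ τ η δ ε : ℝ)
    (Ns : ℕ) (hC0 : 0 ≤ C) (hτ : 0 < τ) (hη : 0 < η)
    (hδ : δ ∈ Set.Icc (1/10 : ℝ) (2/5 : ℝ)) (hμ₀ : |μ₀| ≤ 4)
    (hKη : (2 * C + 4) * η = ε / 2) (hSK : 2 * (2 * C + 4) ≤ ε * (side : ℝ) ^ 2 / 2)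
    (hNs2 : Ns ≤ 2 * side ^ 2) (hF0 : F μ₀ = E Ns - μ₀ * Ns)
    (hFp : F (μ₀ + τ) ≤ E Ns - (μ₀ + τ) * Ns) (hFm : F (μ₀ - τ) ≤ E Ns - (μ₀ - τ) * Ns)
    (hk1 : |(F (μ₀ + τ) / (side : ℝ) ^ 2 - F μ₀ / (side : ℝ) ^ 2) / τ - -(1 - δ)| ≤ η)
    (hk2 : |(F μ₀ / (side : ℝ) ^ 2 - F (μ₀ - τ) / (side : ℝ) ^ 2) / τ - -(1 - δ)| ≤ η)
    (hdown : ∀ n : ℕ, 1 ≤ n → n ≤ 2 * side ^ 2 → E (n - 1) ≤ E n + C * (side : ℝ) ^ 2 / n)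
    (hup : ∀ n : ℕ, n + 1 ≤ 2 * side ^ 2 →
      E (n + 1) ≤ E n + C * (side : ℝ) ^ 2 / (2 * (side : ℝ) ^ 2 - n))
    (hsz : ∀ N : ℕ, Even N → N ≤ 2 * side ^ 2 → Esz N = E N) :
    Esz (2 * ⌊(1 - δ) * (side : ℝ) ^ 2 / 2⌋₊) - μ₀ * ((2 * ⌊(1 - δ) * (side : ℝ) ^ 2 / 2⌋₊ : ℕ) : ℝ) ≤
      F μ₀ + ε * (side : ℝ) ^ 2 := by
  -- the scale S = side²
  have hsideR : (5 : ℝ) ≤ (side : ℝ) := by exact_mod_cast hside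
  have hSpos : (0 : ℝ) < (side : ℝ) ^ 2 := by positivity
  have hS25 : (25 : ℝ) ≤ (side : ℝ) ^ 2 := by nlinarith
  have hcast2 : ((2 * side ^ 2 : ℕ) : ℝ) = 2 * (side : ℝ) ^ 2 := by push_cast; ring
  set S : ℝ := (side : ℝ) ^ 2 with hS
  have hK : 0 < 2 * C + 4 := by linarith
  have hδ1 : (1 : ℝ) / 10 ≤ δ := hδ.1
  have hδ2 : δ ≤ 2 / 5 := hδ.2
  have hδS0 : 0 ≤ δ * S := mul_nonneg (by linarith) hSpos.le
  have hδS2 : δ * S ≤ 2 / 5 * S := mul_le_mul_of_nonneg_right hδ2 hSpos.le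
  have hηS0 : 0 ≤ η * S := mul_nonneg hη.le hSpos.le
  -- supergradient bracket of Ns from the kink inequalities (expanded, linear in the atoms)
  have hNs_le : (Ns : ℝ) ≤ S - δ * S + η * S := by
    have h1 : -(1 - δ) - η ≤ (F (μ₀ + τ) / S - F μ₀ / S) / τ := by
      have := (abs_le.1 hk1).1; linarith
    have h2 : (F (μ₀ + τ) / S - F μ₀ / S) / τ ≤ -(Ns : ℝ) / S := by
      rw [div_le_iff₀ hτ, ← sub_div, div_le_iff₀ hSpos]
      have : -(Ns : ℝ) / S * τ * S = -(τ * Ns) := by field_simp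
      rw [this]; linarith
    have h3 := h1.trans h2
    rw [le_div_iff₀ hSpos] at h3
    nlinarith
  have hNs_ge : S - δ * S - η * S ≤ (Ns : ℝ) := by
    have h1 : (F μ₀ / S - F (μ₀ - τ) / S) / τ ≤ -(1 - δ) + η := by
      have := (abs_le.1 hk2).2; linarith
    have h2 : -(Ns : ℝ) / S ≤ (F μ₀ / S - F (μ₀ - τ) / S) / τ := by
      rw [le_div_iff₀ hτ, ← sub_div, le_div_iff₀ hSpos]
      have : -(Ns : ℝ) / S * τ * S = -(τ * Ns) := by field_simp
      rw [this]; linarith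
    have h3 := h2.trans h1
    rw [div_le_iff₀ hSpos] at h3
    nlinarith
  -- N_L and its bracket
  have hx : 0 ≤ (1 - δ) * S := by nlinarith
  obtain ⟨hNLlo, hNLhi⟩ := twoFloorHalfBounds hx
  set NL : ℕ := 2 * ⌊(1 - δ) * S / 2⌋₊ with hNL
  clear_value NL
  have hNLloR : S - δ * S - 2 ≤ (NL : ℝ) := by linarith
  have hNLhiR : (NL : ℝ) ≤ S - δ * S := by linarith
  have hNL_nat : NL ≤ 2 * side ^ 2 := by
    have h : (NL : ℝ) ≤ ((2 * side ^ 2 : ℕ) : ℝ) := by rw [hcast2]; linarith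
    exact_mod_cast h
  have hdist : |(Ns : ℝ) - NL| ≤ η * S + 2 := by
    rw [abs_le]; constructor <;> linarith
  -- the walk from N* to N_L, each step costing ≤ 2C
  have hwalk : E NL ≤ E Ns + 2 * C * |(Ns : ℝ) - NL| := by
    rcases Nat.lt_or_ge Ns NL with hlt | hle
    · -- walk up from Ns to NL
      obtain ⟨k, hk⟩ : ∃ k, NL = Ns + k := ⟨NL - Ns, by omega⟩
      have hstep : ∀ n : ℕ, Ns ≤ n → n < Ns + k → E (n + 1) ≤ E n + 2 * C := by
        intro n _ hn2
        have hnNL : n + 1 ≤ NL := by omega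
        have hn_lt : n + 1 ≤ 2 * side ^ 2 := le_trans hnNL hNL_nat
        have hcost := hup n hn_lt
        have hnR : (n : ℝ) + 1 ≤ NL := by exact_mod_cast hnNL
        have hnS : (n : ℝ) ≤ S := by linarith
        have hdenpos : 0 < 2 * S - n := by linarith
        have hmul : C * S ≤ C * (2 * (2 * S - n)) := mul_le_mul_of_nonneg_left (by linarith) hC0
        have hbd : C * S / (2 * S - n) ≤ 2 * C := by
          rw [div_le_iff₀ hdenpos]; linarith
        exact hcost.trans (by linarith)
      have hw := walkUp E (2 * C) Ns k hstep
      rw [← hk] at hw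
      have habs : |(Ns : ℝ) - NL| = k := by
        rw [hk]; push_cast; rw [abs_of_nonpos (by linarith)]; ring
      rw [habs]; linarith
    · -- walk down from Ns to NL
      obtain ⟨k, hk⟩ : ∃ k, Ns = NL + k := ⟨Ns - NL, by omega⟩
      have hstep : ∀ n : ℕ, NL < n → n ≤ NL + k → E (n - 1) ≤ E n + 2 * C := by
        intro n hn1 hn2
        have hn_le : n ≤ 2 * side ^ 2 := by
          have : NL + k ≤ 2 * side ^ 2 := hk ▸ hNs2
          exact le_trans hn2 this
        have hn1' : 1 ≤ n := by omega
        have hcost := hdown n hn1' hn_le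
        have hnNL : NL + 1 ≤ n := hn1
        have hnR : (NL : ℝ) + 1 ≤ n := by exact_mod_cast hnNL
        have hnhalf : S ≤ 2 * (n : ℝ) := by linarith
        have hnpos : (0 : ℝ) < n := by linarith
        have hmul : C * S ≤ C * (2 * (n : ℝ)) := mul_le_mul_of_nonneg_left hnhalf hC0
        have hbd : C * S / n ≤ 2 * C := by
          rw [div_le_iff₀ hnpos]; linarith
        exact hcost.trans (by linarith)
      have hw := walkDown E (2 * C) NL k hstep
      rw [← hk] at hw
      have habs : |(Ns : ℝ) - NL| = k := by
        rw [hk]; push_cast; rw [abs_of_nonneg (by linarith)]; ring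
      rw [habs]; linarith
  -- assemble
  have hμterm : μ₀ * ((Ns : ℝ) - NL) ≤ 4 * |(Ns : ℝ) - NL| := by
    calc μ₀ * ((Ns : ℝ) - NL) ≤ |μ₀ * ((Ns : ℝ) - NL)| := le_abs_self _
      _ = |μ₀| * |(Ns : ℝ) - NL| := abs_mul _ _
      _ ≤ 4 * |(Ns : ℝ) - NL| := mul_le_mul_of_nonneg_right hμ₀ (abs_nonneg _)
  have hKdist : (2 * C + 4) * |(Ns : ℝ) - NL| ≤ (2 * C + 4) * (η * S + 2) :=
    mul_le_mul_of_nonneg_left hdist hK.le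
  have hfin : (2 * C + 4) * (η * S + 2) ≤ ε * S := by
    have : (2 * C + 4) * (η * S + 2) = ((2 * C + 4) * η) * S + 2 * (2 * C + 4) := by ring
    rw [this, hKη]; linarith
  have hsplit : (2 * C + 4) * |(Ns : ℝ) - NL| = 2 * C * |(Ns : ℝ) - NL| + 4 * |(Ns : ℝ) - NL| := by
    ring
  rw [hsz NL (hNL ▸ even_two_mul _) hNL_nat]
  have hexp : E NL - μ₀ * (NL : ℝ) = (E NL - E Ns) + (E Ns - μ₀ * Ns) + μ₀ * ((Ns : ℝ) - NL) := by
    ring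
  rw [hexp, ← hF0]
  linarith [hwalk, hμterm, hKdist, hfin, hsplit]

/-! ### The finite-volume closer -/

/-- **Secant closer** (`stub_closerSecant`). Ground-sector existence + `S^z = 0` realises the even
sector minimum + an `L`-uniform `T = 0` one-particle cost + the finite-volume SECANT BRACKET at an
`L`-independent `μ₀` ⟹ HULL TOUCH at `N_L = 2⌊(1−δ)L²/2⌋₊` with slope `μ₀`. (The closer with the kink
step removed: `closerCore` does the supergradient bracket and the walk.) -/
theorem stub_closerSecant :
    (∀ (L : ℕ) [NeZero L] (U μ g : ℝ),
      (∃ N : ℕ, N ≤ 2 * L ^ 2 ∧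
        (hubbardTorusWith 2 L 1 U μ - ((g / (L : ℝ) ^ 2 : ℝ) : ℂ) •
          ((pairField dWaveFormFactor L)ᴴ * pairField dWaveFormFactor L)).groundEnergy =
        (hubbardTorus 2 L 1 U - ((g / (L : ℝ) ^ 2 : ℝ) : ℂ) •
          ((pairField dWaveFormFactor L)ᴴ * pairField dWaveFormFactor L)).minEnergyOn
            (nParticleSubmodule N) - μ * N) ∧
      ∀ N : ℕ, N ≤ 2 * L ^ 2 →
        (hubbardTorusWith 2 L 1 U μ - ((g / (L : ℝ) ^ 2 : ℝ) : ℂ) •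
          ((pairField dWaveFormFactor L)ᴴ * pairField dWaveFormFactor L)).groundEnergy ≤
        (hubbardTorus 2 L 1 U - ((g / (L : ℝ) ^ 2 : ℝ) : ℂ) •
          ((pairField dWaveFormFactor L)ᴴ * pairField dWaveFormFactor L)).minEnergyOn
            (nParticleSubmodule N) - μ * N) →
    (∀ (L : ℕ) [NeZero L] (U g : ℝ) (N : ℕ), Even N → N ≤ 2 * L ^ 2 →
      (hubbardTorus 2 L 1 U - ((g / (L : ℝ) ^ 2 : ℝ) : ℂ) •
        ((pairField dWaveFormFactor L)ᴴ * pairField dWaveFormFactor L)).minEnergyOn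
          (szSector N 0) =
      (hubbardTorus 2 L 1 U - ((g / (L : ℝ) ^ 2 : ℝ) : ℂ) •
        ((pairField dWaveFormFactor L)ᴴ * pairField dWaveFormFactor L)).minEnergyOn
          (nParticleSubmodule N)) →
    (∀ (U g : ℝ), 0 ≤ U → 0 ≤ g → ∃ C : ℝ, 0 ≤ C ∧ ∀ (L : ℕ) [NeZero L] (N : ℕ),
      (1 ≤ N → N ≤ 2 * L ^ 2 →
        (hubbardTorus 2 L 1 U - ((g / (L : ℝ) ^ 2 : ℝ) : ℂ) •
          ((pairField dWaveFormFactor L)ᴴ * pairField dWaveFormFactor L)).minEnergyOn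
            (nParticleSubmodule (N - 1)) ≤
        (hubbardTorus 2 L 1 U - ((g / (L : ℝ) ^ 2 : ℝ) : ℂ) •
          ((pairField dWaveFormFactor L)ᴴ * pairField dWaveFormFactor L)).minEnergyOn
            (nParticleSubmodule N) + C * (L : ℝ) ^ 2 / N) ∧
      (N + 1 ≤ 2 * L ^ 2 →
        (hubbardTorus 2 L 1 U - ((g / (L : ℝ) ^ 2 : ℝ) : ℂ) •
          ((pairField dWaveFormFactor L)ᴴ * pairField dWaveFormFactor L)).minEnergyOn
            (nParticleSubmodule (N + 1)) ≤
        (hubbardTorus 2 L 1 U - ((g / (L : ℝ) ^ 2 : ℝ) : ℂ) •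
          ((pairField dWaveFormFactor L)ᴴ * pairField dWaveFormFactor L)).minEnergyOn
            (nParticleSubmodule N) + C * (L : ℝ) ^ 2 / (2 * (L : ℝ) ^ 2 - N))) →
    (∀ δ ∈ Set.Icc (1/10 : ℝ) (2/5 : ℝ), ∃ μ₁ μ₂ : ℝ, -4 < μ₁ ∧ μ₁ ≤ μ₂ ∧ μ₂ < 0 ∧
      ∃ U₀ : ℝ, 0 < U₀ ∧ ∀ U ∈ Set.Ioc (0 : ℝ) U₀, ∀ g ∈ Set.Ioc (0 : ℝ) (1 / 10),
        ∃ μ₀ ∈ Set.Icc μ₁ μ₂, ∀ η : ℝ, 0 < η → ∃ τ : ℝ, 0 < τ ∧ ∃ L₀ : ℕ, ∀ (L : ℕ) [NeZero L], L₀ ≤ L →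
          -(1 - δ) - η ≤
            ((hubbardTorusWith 2 L 1 U (μ₀ + τ) - ((g / (L : ℝ) ^ 2 : ℝ) : ℂ) •
                ((pairField dWaveFormFactor L)ᴴ * pairField dWaveFormFactor L)).groundEnergy -
              (hubbardTorusWith 2 L 1 U μ₀ - ((g / (L : ℝ) ^ 2 : ℝ) : ℂ) •
                ((pairField dWaveFormFactor L)ᴴ * pairField dWaveFormFactor L)).groundEnergy) /
              (τ * (L : ℝ) ^ 2) ∧
          ((hubbardTorusWith 2 L 1 U μ₀ - ((g / (L : ℝ) ^ 2 : ℝ) : ℂ) •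
                ((pairField dWaveFormFactor L)ᴴ * pairField dWaveFormFactor L)).groundEnergy -
              (hubbardTorusWith 2 L 1 U (μ₀ - τ) - ((g / (L : ℝ) ^ 2 : ℝ) : ℂ) •
                ((pairField dWaveFormFactor L)ᴴ * pairField dWaveFormFactor L)).groundEnergy) /
              (τ * (L : ℝ) ^ 2) ≤ -(1 - δ) + η) →
    ∀ δ ∈ Set.Icc (1/10 : ℝ) (2/5 : ℝ), ∃ μ₁ μ₂ : ℝ, -4 < μ₁ ∧ μ₁ ≤ μ₂ ∧ μ₂ < 0 ∧ ∃ U₀ : ℝ, 0 < U₀ ∧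
      ∀ U ∈ Set.Ioc (0 : ℝ) U₀, ∀ g ∈ Set.Ioc (0 : ℝ) (1 / 10), ∃ μ ∈ Set.Icc μ₁ μ₂, ∀ ε : ℝ, 0 < ε →
        ∃ L₀ : ℕ, ∀ (L : ℕ) [NeZero L], L₀ ≤ L →
          (hubbardTorus 2 L 1 U - ((g / (L : ℝ) ^ 2 : ℝ) : ℂ) •
            ((pairField dWaveFormFactor L)ᴴ * pairField dWaveFormFactor L)).minEnergyOn
              (szSector (2 * ⌊(1 - δ) * (L : ℝ) ^ 2 / 2⌋₊) 0) -
            μ * ((2 * ⌊(1 - δ) * (L : ℝ) ^ 2 / 2⌋₊ : ℕ) : ℝ) ≤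
          (hubbardTorusWith 2 L 1 U μ - ((g / (L : ℝ) ^ 2 : ℝ) : ℂ) •
            ((pairField dWaveFormFactor L)ᴴ * pairField dWaveFormFactor L)).groundEnergy +
            ε * (L : ℝ) ^ 2 := by
  intro hGS hEven hCost hSB δ hδ
  obtain ⟨μ₁, μ₂, hμ₁, hμ₁₂, hμ₂, U₀, hU₀, hU⟩ := hSB δ hδ
  refine ⟨μ₁, μ₂, hμ₁, hμ₁₂, hμ₂, U₀, hU₀, fun U hUm g hg => ?_⟩
  obtain ⟨μ₀, hμ₀m, hsec⟩ := hU U hUm g hg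
  refine ⟨μ₀, hμ₀m, fun ε hε => ?_⟩
  obtain ⟨C, hC0, hC⟩ := hCost U g hUm.1.le hg.1.le
  have hKpos : 0 < 2 * C + 4 := by linarith
  set η : ℝ := ε / (2 * (2 * C + 4)) with hη
  have hηpos : 0 < η := by rw [hη]; positivity
  have hKη : (2 * C + 4) * η = ε / 2 := by rw [hη]; field_simp
  obtain ⟨τ, hτ, L₁, hsecant⟩ := hsec η hηpos
  refine ⟨max L₁ (max 5 (⌈4 * (2 * C + 4) / ε⌉₊ + 1)), fun L _ hL => ?_⟩
  have hL1 : L₁ ≤ L := le_trans (le_max_left _ _) hL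
  have hL5 : 5 ≤ L := le_trans (le_trans (le_max_left _ _) (le_max_right _ _)) hL
  have hLK : ⌈4 * (2 * C + 4) / ε⌉₊ + 1 ≤ L :=
    le_trans (le_trans (le_max_right _ _) (le_max_right _ _)) hL
  obtain ⟨hs1, hs2⟩ := hsecant L hL1
  have hLpos : (0 : ℝ) < (L : ℝ) ^ 2 := cast_sq_pos_of_neZero L
  -- the scale condition 2(2C+4) ≤ ε L²/2
  have hSK : 2 * (2 * C + 4) ≤ ε * (L : ℝ) ^ 2 / 2 := by
    have h1 : (4 * (2 * C + 4) / ε : ℝ) ≤ (⌈4 * (2 * C + 4) / ε⌉₊ : ℝ) := Nat.le_ceil _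
    have h2 : ((⌈4 * (2 * C + 4) / ε⌉₊ : ℕ) : ℝ) + 1 ≤ (L : ℝ) := by exact_mod_cast hLK
    have h3 : (1 : ℝ) ≤ (L : ℝ) := by exact_mod_cast (show 1 ≤ L by omega)
    have h4 : (L : ℝ) ≤ (L : ℝ) ^ 2 := by nlinarith
    have h5 : 4 * (2 * C + 4) / ε ≤ (L : ℝ) ^ 2 := by linarith
    rw [div_le_iff₀ hε] at h5
    linarith
  -- secant bracket ⟹ the kink inequalities in `closerCore` form
  set Fp := (hubbardTorusWith 2 L 1 U (μ₀ + τ) - ((g / (L : ℝ) ^ 2 : ℝ) : ℂ) •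
    ((pairField dWaveFormFactor L)ᴴ * pairField dWaveFormFactor L)).groundEnergy with hFp_def
  set F0 := (hubbardTorusWith 2 L 1 U μ₀ - ((g / (L : ℝ) ^ 2 : ℝ) : ℂ) •
    ((pairField dWaveFormFactor L)ᴴ * pairField dWaveFormFactor L)).groundEnergy with hF0_def
  set Fm := (hubbardTorusWith 2 L 1 U (μ₀ - τ) - ((g / (L : ℝ) ^ 2 : ℝ) : ℂ) •
    ((pairField dWaveFormFactor L)ᴴ * pairField dWaveFormFactor L)).groundEnergy with hFm_def
  have hq1 : (Fp / (L : ℝ) ^ 2 - F0 / (L : ℝ) ^ 2) / τ = (Fp - F0) / (τ * (L : ℝ) ^ 2) := by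
    rw [← sub_div, div_div, mul_comm]
  have hq2 : (F0 / (L : ℝ) ^ 2 - Fm / (L : ℝ) ^ 2) / τ = (F0 - Fm) / (τ * (L : ℝ) ^ 2) := by
    rw [← sub_div, div_div, mul_comm]
  -- the ground sector N* at μ₀ and the supergradient inequalities
  obtain ⟨⟨Ns, hNs2, hF0⟩, -⟩ := hGS L U μ₀ g
  have hFp := (hGS L U (μ₀ + τ) g).2 Ns hNs2
  have hFm := (hGS L U (μ₀ - τ) g).2 Ns hNs2
  -- supergradient inequalities at μ₀ sandwich −Ns/L² between the two secants
  have hτL : 0 < τ * (L : ℝ) ^ 2 := mul_pos hτ hLpos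
  have hscale : -(Ns : ℝ) / (L : ℝ) ^ 2 * (τ * (L : ℝ) ^ 2) = -(τ * Ns) := by field_simp
  have hF0' : F0 = _ := hF0
  have a1 : (Fp - F0) / (τ * (L : ℝ) ^ 2) ≤ -(Ns : ℝ) / (L : ℝ) ^ 2 := by
    rw [div_le_iff₀ hτL, hscale]
    have := hFp; change Fp ≤ _ at this
    linarith
  have a2 : -(Ns : ℝ) / (L : ℝ) ^ 2 ≤ (F0 - Fm) / (τ * (L : ℝ) ^ 2) := by
    rw [le_div_iff₀ hτL, hscale]
    have := hFm; change Fm ≤ _ at this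
    linarith
  have hk1 : |(Fp / (L : ℝ) ^ 2 - F0 / (L : ℝ) ^ 2) / τ - -(1 - δ)| ≤ η := by
    rw [hq1, abs_le]; constructor <;> linarith [hs1, hs2, a1, a2]
  have hk2 : |(F0 / (L : ℝ) ^ 2 - Fm / (L : ℝ) ^ 2) / τ - -(1 - δ)| ≤ η := by
    rw [hq2, abs_le]; constructor <;> linarith [hs1, hs2, a1, a2]
  have hμ₀abs : |μ₀| ≤ 4 := by
    rw [abs_le]; constructor <;> linarith [hμ₀m.1, hμ₀m.2]
  exact closerCore L hL5
    (fun μ => (hubbardTorusWith 2 L 1 U μ - ((g / (L : ℝ) ^ 2 : ℝ) : ℂ) •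
      ((pairField dWaveFormFactor L)ᴴ * pairField dWaveFormFactor L)).groundEnergy)
    (fun N => (hubbardTorus 2 L 1 U - ((g / (L : ℝ) ^ 2 : ℝ) : ℂ) •
      ((pairField dWaveFormFactor L)ᴴ * pairField dWaveFormFactor L)).minEnergyOn
        (nParticleSubmodule N))
    (fun N => (hubbardTorus 2 L 1 U - ((g / (L : ℝ) ^ 2 : ℝ) : ℂ) •
      ((pairField dWaveFormFactor L)ᴴ * pairField dWaveFormFactor L)).minEnergyOn
        (szSector N 0))
    C μ₀ τ η δ ε Ns hC0 hτ hηpos hδ hμ₀abs hKη hSK hNs2 hF0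
    hFp hFm hk1 hk2 (fun n hn1 hn2 => (hC L n).1 hn1 hn2) (fun n hn => (hC L n).2 hn)
    (fun N hN hN2 => hEven L U g N hN hN2)

end

end Summit.HubbardSuperconductivity.HubbardSuperconductivity.Theorems.TwSeededEnsembleEquivalence.ExposedDensity
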